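import Mathlib

/-!
# Dobrowolski's prime lemma: `deg(α^p) < deg(α)` for at most `log₂ deg(α)` primes `p` (Dobrowolski 1979, Lemma 3; Dubickas 2017, Theorem 1.1)

**Statement** [Dobrowolski1979, Lemma 3] (= [Dubickas2017, Theorem 1.1]; another proof: Masser, *Auxiliary Polynomials in
Number Theory* (2016), Lemma 16.3 p. 204). Let `α` be algebraic of degree `d ≥ 2`. Then the set
`U(α) = {n ≥ 1 : deg(α^n) < d}` contains at most `log d / log 2` prime numbers. Equivalently: if `p₁, …, p_r` are
distinct primes with `deg(α^{p_j}) < d` for every `j`, then `2^r ≤ d`.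

**Proof as formalised** (the field-degree core of Dobrowolski's argument; no Galois theory is used). Degrees are
`deg(x) := natDegree (minpoly K x) = [K(x) : K]` for `x` integral over a base field `K` inside an extension field `L`
(printed case `K = ℚ`, `L = ℂ`).
* `natDegree_minpoly_mul_le_of_coprime` — SUPERMULTIPLICATIVITY: for `α ≠ 0` and coprime `m, n`,
  `deg(α)·deg(α^{mn}) ≤ deg(α^m)·deg(α^n)`. Indeed with `F := K(α^{mn})`, Bezout `um + vn = 1` puts `α` in the
  compositum `F(α^m)·F(α^n)`, so `[F(α):F] ≤ [F(α^m):F]·[F(α^n):F]` (`IntermediateField.finrank_sup_le`), and the three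
  tower laws `[K(x):K] = [F:K]·[F(x):F]` (`x = α, α^m, α^n`, each field containing `α^{mn}`) convert this into the claim.
* `two_pow_card_mul_natDegree_minpoly_pow_prod_le` — for a finite set `S` of pairwise coprime exponents with
  `deg(α^n) < deg(α)` for `n ∈ S`: `2^{#S}·deg(α^{∏ S}) ≤ deg(α)`, by induction on `S`: a strict drop `deg(α^p) < deg(α)`
  is a drop by a factor `≥ 2` because `deg(α^p) ∣ deg(α)`, and supermultiplicativity propagates it to `α^{p·∏ S}`.
* `natDegree_minpoly_pow_dvd` — `deg(α^n) ∣ deg(α)` ([Dubickas2017, §1]: each conjugate of `αⁿ` occurs `d/D` times).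
* `two_pow_card_le_natDegree_minpoly` (`2^{#S} ≤ deg(α)`, the hypothesis `α ≠ 0` being automatic),
  `card_le_log_natDegree_minpoly_of_prime` (`#S ≤ Nat.log 2 (deg α)` for a finite set of such primes) and
  `setOf_prime_degree_drop_finite`/`ncard_setOf_prime_degree_drop_le` (the printed form: the set of such primes is finite
  of size `≤ log₂ d`).
Pairwise coprime exponents (not only primes) are allowed throughout. Dubickas's sharpening `φ(n₁⋯n_r) ≤ d`
([Dubickas2017, Theorem 1.2], whence `r ≪ log d / log log d`) and Matveev's version are NOT formalised here.
-/

namespace Literature.NumberTheory.MahlerMeasure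

open IntermediateField Module Polynomial

variable {K L : Type*} [Field K] [Field L] [Algebra K L]

/-- Tower law through a simple subextension: if `y ∈ K(x)` then `[K(y):K]·[K(y)(x):K(y)] = [K(x):K]`.
(Private plumbing.) [folklore] -/
private theorem finrank_adjoin_simple_mul_of_mem {x y : L} (hy : y ∈ K⟮x⟯) :
    finrank K K⟮y⟯ * finrank K⟮y⟯ K⟮y⟯⟮x⟯ = finrank K K⟮x⟯ := by
  have h : K⟮y⟯ ≤ K⟮x⟯ := adjoin_simple_le_iff.mpr hy
  have := finrank_bot_mul_relfinrank h
  rwa [relfinrank_eq_finrank_of_le h, extendScalars_adjoin h] at this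

/-- Bezout step: for `α ≠ 0` and coprime `m, n`, `α` lies in the compositum `F(α^m) ⊔ F(α^n)` over any base
field `F`, hence `[F(α):F] ≤ [F(α^m):F]·[F(α^n):F]` when `α` is integral over `F`. (Private plumbing.)
[folklore] -/
private theorem finrank_adjoin_simple_le_mul_of_coprime {F : Type*} [Field F] [Algebra F L] {α : L}
    (hα : IsIntegral F α) (hα0 : α ≠ 0) {m n : ℕ} (hmn : m.Coprime n) :
    finrank F F⟮α⟯ ≤ finrank F F⟮α ^ m⟯ * finrank F F⟮α ^ n⟯ := by
  haveI : FiniteDimensional F F⟮α ^ m⟯ := adjoin.finiteDimensional (hα.pow m)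
  haveI : FiniteDimensional F F⟮α ^ n⟯ := adjoin.finiteDimensional (hα.pow n)
  have hmem : α ∈ F⟮α ^ m⟯ ⊔ F⟮α ^ n⟯ := by
    obtain ⟨a, b, hab⟩ := (Nat.isCoprime_iff_coprime.mpr hmn : IsCoprime (m : ℤ) (n : ℤ))
    have h1 : α ^ m ∈ F⟮α ^ m⟯ ⊔ F⟮α ^ n⟯ :=
      (le_sup_left : F⟮α ^ m⟯ ≤ F⟮α ^ m⟯ ⊔ F⟮α ^ n⟯) (mem_adjoin_simple_self F (α ^ m))
    have h2 : α ^ n ∈ F⟮α ^ m⟯ ⊔ F⟮α ^ n⟯ :=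
      (le_sup_right : F⟮α ^ n⟯ ≤ F⟮α ^ m⟯ ⊔ F⟮α ^ n⟯) (mem_adjoin_simple_self F (α ^ n))
    have key : (α ^ m) ^ a * (α ^ n) ^ b ∈ F⟮α ^ m⟯ ⊔ F⟮α ^ n⟯ :=
      mul_mem (zpow_mem h1 a) (zpow_mem h2 b)
    have hab' : (m : ℤ) * a + (n : ℤ) * b = 1 := by linear_combination hab
    have heq : (α ^ m) ^ a * (α ^ n) ^ b = α := by
      rw [← zpow_natCast α m, ← zpow_natCast α n, ← zpow_mul, ← zpow_mul, ← zpow_add₀ hα0, hab',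
        zpow_one]
    rwa [heq] at key
  have hle : F⟮α⟯ ≤ F⟮α ^ m⟯ ⊔ F⟮α ^ n⟯ := adjoin_simple_le_iff.mpr hmem
  exact (finrank_le_of_le_right hle).trans (finrank_sup_le _ _)

/-- **Supermultiplicativity of the degree of powers** (the step behind [Dobrowolski1979, Lemma 3]; cf. the
fibre count of [Dubickas2017, §1]): for `α ≠ 0` integral over `K` and coprime `m, n`,
`deg(α)·deg(α^{mn}) ≤ deg(α^m)·deg(α^n)`, where `deg(x) = natDegree (minpoly K x)`. Proof: the Bezout/compositum
inequality over `F = K(α^{mn})` and the tower laws `[K(x):K] = [F:K]·[F(x):F]` for `x = α, α^m, α^n`.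
[cite: Dobrowolski1979, Lemma 3] -/
theorem natDegree_minpoly_mul_le_of_coprime {α : L} (hα : IsIntegral K α) (hα0 : α ≠ 0) {m n : ℕ}
    (hmn : m.Coprime n) :
    (minpoly K α).natDegree * (minpoly K (α ^ (m * n))).natDegree ≤
      (minpoly K (α ^ m)).natDegree * (minpoly K (α ^ n)).natDegree := by
  -- the inequality over the common subfield `F = K(α^{mn})`
  have hI := finrank_adjoin_simple_le_mul_of_coprime (F := K⟮α ^ (m * n)⟯)
    (hα.tower_top (A := K⟮α ^ (m * n)⟯)) hα0 hmn
  -- the three tower laws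
  have hyα : α ^ (m * n) ∈ K⟮α⟯ := pow_mem (mem_adjoin_simple_self K α) _
  have hym : α ^ (m * n) ∈ K⟮α ^ m⟯ := by
    rw [pow_mul]; exact pow_mem (mem_adjoin_simple_self K (α ^ m)) n
  have hyn : α ^ (m * n) ∈ K⟮α ^ n⟯ := by
    rw [mul_comm, pow_mul]; exact pow_mem (mem_adjoin_simple_self K (α ^ n)) m
  have T1 := finrank_adjoin_simple_mul_of_mem (K := K) hyα
  have T2 := finrank_adjoin_simple_mul_of_mem (K := K) hym
  have T3 := finrank_adjoin_simple_mul_of_mem (K := K) hyn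
  rw [← adjoin.finrank hα, ← adjoin.finrank (hα.pow (m * n)), ← adjoin.finrank (hα.pow m),
    ← adjoin.finrank (hα.pow n), ← T1, ← T2, ← T3]
  have hmul := Nat.mul_le_mul_left (finrank K K⟮α ^ (m * n)⟯ * finrank K K⟮α ^ (m * n)⟯) hI
  calc finrank K K⟮α ^ (m * n)⟯ * finrank K⟮α ^ (m * n)⟯ K⟮α ^ (m * n)⟯⟮α⟯ * finrank K K⟮α ^ (m * n)⟯
      = finrank K K⟮α ^ (m * n)⟯ * finrank K K⟮α ^ (m * n)⟯ *
          finrank K⟮α ^ (m * n)⟯ K⟮α ^ (m * n)⟯⟮α⟯ := by ring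
    _ ≤ finrank K K⟮α ^ (m * n)⟯ * finrank K K⟮α ^ (m * n)⟯ *
          (finrank K⟮α ^ (m * n)⟯ K⟮α ^ (m * n)⟯⟮α ^ m⟯ * finrank K⟮α ^ (m * n)⟯ K⟮α ^ (m * n)⟯⟮α ^ n⟯) :=
        hmul
    _ = finrank K K⟮α ^ (m * n)⟯ * finrank K⟮α ^ (m * n)⟯ K⟮α ^ (m * n)⟯⟮α ^ m⟯ *
          (finrank K K⟮α ^ (m * n)⟯ * finrank K⟮α ^ (m * n)⟯ K⟮α ^ (m * n)⟯⟮α ^ n⟯) := by ring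

/-- The degree of a power divides the degree: `deg(α^p) ∣ deg(α)` (`K(α^p) ⊆ K(α)`, tower law) — [Dubickas2017, §1
p. 235]: "if `D = deg(αⁿ)` then the list `α₁ⁿ, …, α_dⁿ` contains each of the `D` conjugates of `αⁿ` exactly `d/D` times".
[cite: Dubickas2017, §1 p.235 (deg(αⁿ) divides deg(α))] -/
theorem natDegree_minpoly_pow_dvd {α : L} (hα : IsIntegral K α) (p : ℕ) :
    (minpoly K (α ^ p)).natDegree ∣ (minpoly K α).natDegree := by
  rw [← adjoin.finrank hα, ← adjoin.finrank (hα.pow p)]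
  exact finrank_dvd_of_le_right (adjoin_simple_le_iff.mpr (pow_mem (mem_adjoin_simple_self K α) p))

/-- **Dobrowolski's Lemma 3, multiplicative form.** For `α ≠ 0` integral over `K` and a finite set `S` of pairwise
coprime exponents with `deg(α^n) < deg(α)` for all `n ∈ S`: `2^{#S} · deg(α^{∏ S}) ≤ deg(α)`. Induction on `S`:
`deg(α^p) ∣ deg(α)` makes each strict drop a halving, and supermultiplicativity
(`natDegree_minpoly_mul_le_of_coprime`) carries it to the product exponent. [cite: Dobrowolski1979, Lemma 3] -/
theorem two_pow_card_mul_natDegree_minpoly_pow_prod_le {α : L} (hα : IsIntegral K α) (hα0 : α ≠ 0)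
    (S : Finset ℕ) (hS : ∀ a ∈ S, ∀ b ∈ S, a ≠ b → Nat.Coprime a b)
    (hlt : ∀ n ∈ S, (minpoly K (α ^ n)).natDegree < (minpoly K α).natDegree) :
    2 ^ S.card * (minpoly K (α ^ ∏ n ∈ S, n)).natDegree ≤ (minpoly K α).natDegree := by
  classical
  induction S using Finset.induction_on with
  | empty => simp
  | insert p S hp ih =>
    have hS' : ∀ a ∈ S, ∀ b ∈ S, a ≠ b → Nat.Coprime a b := fun a ha b hb =>
      hS a (Finset.mem_insert_of_mem ha) b (Finset.mem_insert_of_mem hb)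
    have hlt' : ∀ n ∈ S, (minpoly K (α ^ n)).natDegree < (minpoly K α).natDegree := fun n hn =>
      hlt n (Finset.mem_insert_of_mem hn)
    have ih' := ih hS' hlt'
    have hcop : Nat.Coprime p (∏ n ∈ S, n) :=
      Nat.Coprime.prod_right fun i hi =>
        hS p (Finset.mem_insert_self p S) i (Finset.mem_insert_of_mem hi) (fun h => hp (h ▸ hi))
    have hsm := natDegree_minpoly_mul_le_of_coprime hα hα0 hcop
    have dpos : 0 < (minpoly K α).natDegree := minpoly.natDegree_pos hα
    -- a strict drop is a halving
    have h2 : 2 * (minpoly K (α ^ p)).natDegree ≤ (minpoly K α).natDegree := by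
      obtain ⟨k, hk⟩ := natDegree_minpoly_pow_dvd hα p
      have hp' := hlt p (Finset.mem_insert_self p S)
      rcases k with _ | _ | k
      · rw [hk] at hp'; simp at hp'
      · rw [hk] at hp'; simp at hp'
      · calc 2 * (minpoly K (α ^ p)).natDegree ≤ (k + 1 + 1) * (minpoly K (α ^ p)).natDegree :=
              Nat.mul_le_mul_right _ (by omega)
          _ = (minpoly K α).natDegree := by rw [hk]; ring
    -- hence `2 · deg(α^{p ∏S}) ≤ deg(α^{∏S})`
    have hxz : 2 * (minpoly K (α ^ (p * ∏ n ∈ S, n))).natDegree ≤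
        (minpoly K (α ^ ∏ n ∈ S, n)).natDegree := by
      refine Nat.le_of_mul_le_mul_left ?_ dpos
      calc (minpoly K α).natDegree * (2 * (minpoly K (α ^ (p * ∏ n ∈ S, n))).natDegree)
          = 2 * ((minpoly K α).natDegree * (minpoly K (α ^ (p * ∏ n ∈ S, n))).natDegree) := by ring
        _ ≤ 2 * ((minpoly K (α ^ p)).natDegree * (minpoly K (α ^ ∏ n ∈ S, n)).natDegree) :=
            Nat.mul_le_mul_left 2 hsm
        _ = (2 * (minpoly K (α ^ p)).natDegree) * (minpoly K (α ^ ∏ n ∈ S, n)).natDegree := by ring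
        _ ≤ (minpoly K α).natDegree * (minpoly K (α ^ ∏ n ∈ S, n)).natDegree :=
            Nat.mul_le_mul_right _ h2
    rw [Finset.prod_insert hp, Finset.card_insert_of_notMem hp, pow_succ]
    calc 2 ^ S.card * 2 * (minpoly K (α ^ (p * ∏ n ∈ S, n))).natDegree
        = 2 ^ S.card * (2 * (minpoly K (α ^ (p * ∏ n ∈ S, n))).natDegree) := by ring
      _ ≤ 2 ^ S.card * (minpoly K (α ^ ∏ n ∈ S, n)).natDegree := Nat.mul_le_mul_left _ hxz
      _ ≤ (minpoly K α).natDegree := ih'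

/-- **Dobrowolski's Lemma 3** [Dobrowolski1979, Lemma 3] (= [Dubickas2017, Theorem 1.1]): if `S` is a finite set of
pairwise coprime natural numbers with `deg(α^n) < deg(α)` for every `n ∈ S` (`α` integral over `K`), then
`2^{#S} ≤ deg(α)`. (For `α = 0` the hypothesis forces `S = ∅`.) [cite: Dobrowolski1979, Lemma 3] -/
theorem two_pow_card_le_natDegree_minpoly {α : L} (hα : IsIntegral K α) (S : Finset ℕ)
    (hS : ∀ a ∈ S, ∀ b ∈ S, a ≠ b → Nat.Coprime a b)
    (hlt : ∀ n ∈ S, (minpoly K (α ^ n)).natDegree < (minpoly K α).natDegree) :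
    2 ^ S.card ≤ (minpoly K α).natDegree := by
  by_cases hα0 : α = 0
  · subst hα0
    have hSe : S = ∅ := by
      refine Finset.eq_empty_of_forall_notMem fun n hn => ?_
      have h := hlt n hn
      rw [minpoly.zero, natDegree_X] at h
      have := minpoly.natDegree_pos ((isIntegral_zero : IsIntegral K (0 : L)).pow n)
      omega
    subst hSe
    simp
  · have h := two_pow_card_mul_natDegree_minpoly_pow_prod_le hα hα0 S hS hlt
    have hpos : 0 < (minpoly K (α ^ ∏ n ∈ S, n)).natDegree := minpoly.natDegree_pos (hα.pow _)
    calc 2 ^ S.card = 2 ^ S.card * 1 := (mul_one _).symm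
      _ ≤ 2 ^ S.card * (minpoly K (α ^ ∏ n ∈ S, n)).natDegree := Nat.mul_le_mul_left _ hpos
      _ ≤ (minpoly K α).natDegree := h

/-- **Dobrowolski's Lemma 3, logarithmic prime form**: a finite set `S` of primes `p` with `deg(α^p) < deg(α)` has
`#S ≤ ⌊log₂ deg(α)⌋` (`Nat.log 2`). [cite: Dobrowolski1979, Lemma 3] -/
theorem card_le_log_natDegree_minpoly_of_prime {α : L} (hα : IsIntegral K α) (S : Finset ℕ)
    (hS : ∀ p ∈ S, p.Prime)
    (hlt : ∀ p ∈ S, (minpoly K (α ^ p)).natDegree < (minpoly K α).natDegree) :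
    S.card ≤ Nat.log 2 (minpoly K α).natDegree := by
  have h := two_pow_card_le_natDegree_minpoly hα S
    (fun a ha b hb hab => (Nat.coprime_primes (hS a ha) (hS b hb)).mpr hab) hlt
  exact Nat.le_log_of_pow_le (by norm_num) h

/-- The printed statement of [Dobrowolski1979, Lemma 3] / [Dubickas2017, Theorem 1.1], finiteness half: the set of
primes `p` with `deg(α^p) < deg(α)` is finite. [cite: Dobrowolski1979, Lemma 3] -/
theorem setOf_prime_degree_drop_finite {α : L} (hα : IsIntegral K α) :
    {p : ℕ | p.Prime ∧ (minpoly K (α ^ p)).natDegree < (minpoly K α).natDegree}.Finite := by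
  by_contra hinf
  obtain ⟨t, ht, hcard⟩ := Set.Infinite.exists_subset_card_eq hinf (Nat.log 2 (minpoly K α).natDegree + 1)
  have h := card_le_log_natDegree_minpoly_of_prime hα t (fun p hp => (ht hp).1) (fun p hp => (ht hp).2)
  omega

/-- The printed statement of [Dobrowolski1979, Lemma 3] / [Dubickas2017, Theorem 1.1]: the set
`{p prime : deg(α^p) < deg(α)}` has at most `log₂ deg(α)` elements (`Set.ncard`, `Nat.log 2`).
[cite: Dobrowolski1979, Lemma 3] -/
theorem ncard_setOf_prime_degree_drop_le {α : L} (hα : IsIntegral K α) :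
    {p : ℕ | p.Prime ∧ (minpoly K (α ^ p)).natDegree < (minpoly K α).natDegree}.ncard ≤
      Nat.log 2 (minpoly K α).natDegree := by
  have hfin := setOf_prime_degree_drop_finite hα
  rw [Set.ncard_eq_toFinset_card _ hfin]
  exact card_le_log_natDegree_minpoly_of_prime hα _ (fun p hp => ((Set.Finite.mem_toFinset hfin).mp hp).1)
    (fun p hp => ((Set.Finite.mem_toFinset hfin).mp hp).2)

end Literature.NumberTheory.MahlerMeasure
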